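import Mathlib
import Summits.Ventures.PercRepro2.SwOutCrossGenThm

/-!
# The generic cross-arm cube with far arms (blind cell PercRepro2, night-4 g23, 2026-08-28;
proofs/NIGHT4-G23.md §6′, §8)

The several-arms base of g20/g21 carries FAR ARMS `F k` (`k : κ`): arms of `h` not adjacent to
`u`, flipped as one class each, never leaking, red atoms when red.  A point is `(f, q)` with
`f : Config κ` the far-arm bits; the atoms are `AtomG A ι ⊕ κ`; the type is `(f, typG q)` ordered
with `f' ≤ f` better (a blue far arm is a red hub of the outside).  **`card_le_crossGenFar`**
follows from `card_le_crossGen` in two steps, for every fibre data, as g21's `far_card_le` follows from the frozen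
inequality: (1) with `f` FROZEN, the inequality on the fibre `{q : (f, q) ∈ Q}` is the one of
`card_le_crossGen` for the up-set `𝒯_f` of types and the up-set `𝓔_f = {A | A ∪ F_f ∈ 𝓔}` — the
right-hand side counts the blue atoms of `q` together with the RED far arms of `f` (`EBTG`); (2)
on the fibre `{f : (f, q) ∈ Q}` — a lower set of the far-arm cube — `f ↦ EBTG F (f, q)` is
increasing and `EBG F (f, q) = EBTG F (flipAll f, q)`, so the cube principle turns `EBTG` into `EBG F`.
-/

namespace Summit.Ventures.PercRepro2

namespace CrossArm

open LocRows

variable {W A L : Type*} {F : FibreData W A L} {ι κ : Type*}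

open scoped Classical

section Defs

variable (F)

/-- A point with far arms. -/
abbrev PtFG (W ι κ : Type*) := Config κ × PtG W ι

/-- The atoms with far arms. -/
abbrev AtomFG (A ι κ : Type*) := AtomG A ι ⊕ κ

/-- The far-arm atoms of `f`. -/
def farAtoms (f : Config κ) : Set (AtomFG A ι κ) := fun a =>
  match a with
  | Sum.inl _ => False
  | Sum.inr k => f k = true

/-- The red atoms of a point with far arms. -/
def ERFG (x : PtFG W ι κ) : Set (AtomFG A ι κ) := Sum.inl '' ERG F x.2 ∪ farAtoms x.1

/-- The blue atoms of `q` together with the red far arms of `f` (the far arms frozen). -/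
def EBTG (x : PtFG W ι κ) : Set (AtomFG A ι κ) := Sum.inl '' EBG F x.2 ∪ farAtoms x.1

/-- The blue atoms of a point with far arms. -/
def EBFG (x : PtFG W ι κ) : Set (AtomFG A ι κ) := Sum.inl '' EBG F x.2 ∪ farAtoms (flipAll x.1)

/-- The type of a point with far arms. -/
abbrev TypFG (L ι κ : Type*) := Config κ × TypG L ι

/-- The type of a point with far arms. -/
def typFG (x : PtFG W ι κ) : TypFG L ι κ := (x.1, typG F x.2)

/-- `t'` is at least as good a type as `t`: no more red far arms, and better on the rest. -/
def BetterFG (t' t : TypFG L ι κ) : Prop :=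
  (∀ k, t.1 k = false → t'.1 k = false) ∧ BetterG F t'.2 t.2

/-- An up-set of types with far arms. -/
def IsUpFG (𝒯 : Set (TypFG L ι κ)) : Prop := ∀ t ∈ 𝒯, ∀ t', BetterFG F t' t → t' ∈ 𝒯

variable [Fintype ι] [DecidableEq ι] [Fintype κ] [DecidableEq κ] [Fintype W] [DecidableEq W]

/-- The non-leaking points with far arms whose type lies in `𝒯`. -/
noncomputable def QFG (𝒯 : Set (TypFG L ι κ)) : Finset (PtFG W ι κ) :=
  Finset.univ.filter fun x => ¬ LeakG F x.2 ∧ typFG F x ∈ 𝒯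

/-- The slice of `𝒯` at the far-arm bits `f`. -/
def sliceTG (𝒯 : Set (TypFG L ι κ)) (f : Config κ) : Set (TypG L ι) := {t | (f, t) ∈ 𝒯}

/-- The up-set `𝓔` with the far arms of `f` added. -/
def sliceEG (𝓔 : Set (Set (AtomFG A ι κ))) (f : Config κ) : Set (Set (AtomG A ι)) :=
  {A | Sum.inl '' A ∪ farAtoms f ∈ 𝓔}

end Defs

section Pure

variable {𝒯 : Set (TypFG L ι κ)} {𝓔 : Set (Set (AtomFG A ι κ))}

/-- The slice of an up-set of types is an up-set. -/
lemma isUpG_sliceTG (h𝒯 : IsUpFG F 𝒯) (f : Config κ) : IsUpG F (sliceTG 𝒯 f) :=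
  fun _ ht _ hb => h𝒯 _ ht _ ⟨fun _ h => h, hb⟩

/-- The slice of an up-set of atom sets is an up-set. -/
lemma isUpperSet_sliceEG (h𝓔 : IsUpperSet 𝓔) (f : Config κ) : IsUpperSet (sliceEG 𝓔 f) := by
  intro A B hAB hA
  exact h𝓔 (Set.union_subset_union_left _ (Set.image_mono hAB)) hA

/-- `farAtoms` is monotone. -/
lemma farAtoms_monoG {f f' : Config κ} (h : f ≤ f') :
    (farAtoms f : Set (AtomFG A ι κ)) ⊆ farAtoms f' := by
  intro a ha
  cases a with
  | inl _ => exact ha.elim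
  | inr k => exact Bool.le_iff_imp.1 (h k) ha

/-- `flipAll` is antitone (far-arm cube). -/
lemma flipAll_antitone' {f f' : Config κ} (h : f ≤ f') : flipAll f' ≤ flipAll f := by
  intro k
  have := h k
  unfold flipAll
  cases hs : f k <;> cases hs' : f' k <;> simp_all

/-- `EBFG` is `EBTG` at the flipped far arms. -/
lemma EBFG_eq (x : PtFG W ι κ) : EBFG F x = EBTG F (flipAll x.1, x.2) := rfl

/-- The far-arm fibre of `QFG` at `q`. -/
def DqG (F : FibreData W A L) (𝒯 : Set (TypFG L ι κ)) (q : PtG W ι) : Set (Config κ) :=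
  {f | (f, typG F q) ∈ 𝒯}

/-- The far-arm fibre is a lower set. -/
lemma isLowerSet_DqG (h𝒯 : IsUpFG F 𝒯) (q : PtG W ι) : IsLowerSet (DqG F 𝒯 q) := by
  intro f f' hle hf
  refine h𝒯 _ hf _ ⟨fun k hk => ?_, ⟨fun _ h => h, F.betterL_refl _⟩⟩
  have := hle k
  simp only at hk ⊢
  rw [hk] at this
  cases h' : f' k with
  | false => rfl
  | true =>
    rw [h'] at this
    exact absurd (Bool.le_iff_imp.1 this rfl) (by decide)

end Pure

section Thm

variable [Fintype ι] [DecidableEq ι] [Fintype κ] [DecidableEq κ] [Fintype W] [DecidableEq W]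
  {𝒯 : Set (TypFG L ι κ)} {𝓔 : Set (Set (AtomFG A ι κ))}

omit [DecidableEq W] in
/-- Membership in `QFG`. -/
lemma mem_QFG {x : PtFG W ι κ} : x ∈ QFG F 𝒯 ↔ ¬ LeakG F x.2 ∧ typFG F x ∈ 𝒯 := by
  simp only [QFG, Finset.mem_filter, Finset.mem_univ, true_and]

variable [Nonempty ι]

/-- **Step 1, the frozen inequality at fixed `f`**: the fibre of `QFG F` at `f` is `QG F` of the sliced
up-set, and the inequality is `card_le_crossGen`. -/
lemma card_frozen_leG (h𝒯 : IsUpFG F 𝒯) (h𝓔 : IsUpperSet 𝓔) (f : Config κ) :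
    ((QFG F 𝒯).filter fun x => x.1 = f ∧ ERFG F x ∈ 𝓔).card ≤
      ((QFG F 𝒯).filter fun x => x.1 = f ∧ EBTG F x ∈ 𝓔).card := by
  have key := card_le_crossGen (isUpG_sliceTG h𝒯 f) (isUpperSet_sliceEG h𝓔 f)
  have e1 : ((QFG F 𝒯).filter fun x => x.1 = f ∧ ERFG F x ∈ 𝓔).card =
      ((QG F (sliceTG 𝒯 f)).filter fun q => ERG F q ∈ sliceEG 𝓔 f).card := by
    refine Finset.card_bij' (fun x _ => x.2) (fun q _ => (f, q)) ?_ ?_ ?_ ?_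
    · intro x hx
      rw [Finset.mem_filter, mem_QFG] at hx
      obtain ⟨⟨hl, ht⟩, hf, hE⟩ := hx
      rw [Finset.mem_filter, mem_QG]
      refine ⟨⟨hl, ?_⟩, ?_⟩
      · show (f, typG F x.2) ∈ 𝒯
        rw [← hf]; exact ht
      · show Sum.inl '' ERG F x.2 ∪ farAtoms f ∈ 𝓔
        rw [← hf]; exact hE
    · intro q hq
      rw [Finset.mem_filter, mem_QG] at hq
      obtain ⟨⟨hl, ht⟩, hE⟩ := hq
      rw [Finset.mem_filter, mem_QFG]
      exact ⟨⟨hl, ht⟩, rfl, hE⟩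
    · intro x hx
      rw [Finset.mem_filter] at hx
      exact Prod.ext hx.2.1.symm rfl
    · intro q _
      rfl
  have e2 : ((QFG F 𝒯).filter fun x => x.1 = f ∧ EBTG F x ∈ 𝓔).card =
      ((QG F (sliceTG 𝒯 f)).filter fun q => EBG F q ∈ sliceEG 𝓔 f).card := by
    refine Finset.card_bij' (fun x _ => x.2) (fun q _ => (f, q)) ?_ ?_ ?_ ?_
    · intro x hx
      rw [Finset.mem_filter, mem_QFG] at hx
      obtain ⟨⟨hl, ht⟩, hf, hE⟩ := hx
      rw [Finset.mem_filter, mem_QG]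
      refine ⟨⟨hl, ?_⟩, ?_⟩
      · show (f, typG F x.2) ∈ 𝒯
        rw [← hf]; exact ht
      · show Sum.inl '' EBG F x.2 ∪ farAtoms f ∈ 𝓔
        rw [← hf]; exact hE
    · intro q hq
      rw [Finset.mem_filter, mem_QG] at hq
      obtain ⟨⟨hl, ht⟩, hE⟩ := hq
      rw [Finset.mem_filter, mem_QFG]
      exact ⟨⟨hl, ht⟩, rfl, hE⟩
    · intro x hx
      rw [Finset.mem_filter] at hx
      exact Prod.ext hx.2.1.symm rfl
    · intro q _
      rfl
  rw [e1, e2]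
  exact key

omit [Nonempty ι] in
/-- **Step 2, the far-arm cube principle at fixed `q`**: `EBTG` counts at most as much as `EBFG`. -/
lemma card_far_leG (h𝒯 : IsUpFG F 𝒯) (h𝓔 : IsUpperSet 𝓔) (q : PtG W ι) :
    ((QFG F 𝒯).filter fun x => x.2 = q ∧ EBTG F x ∈ 𝓔).card ≤
      ((QFG F 𝒯).filter fun x => x.2 = q ∧ EBFG F x ∈ 𝓔).card := by
  by_cases hl : LeakG F q
  · have h0 : ((QFG F 𝒯).filter fun x => x.2 = q ∧ EBTG F x ∈ 𝓔) = ∅ := by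
      rw [Finset.filter_eq_empty_iff]
      rintro x hx ⟨hq, -⟩
      exact (mem_QFG.1 hx).1 (hq ▸ hl)
    rw [h0, Finset.card_empty]
    exact Nat.zero_le _
  -- the counts over the far-arm cube
  set A : Set (Config κ) := {f | Sum.inl '' EBG F q ∪ farAtoms f ∈ 𝓔} with hA
  have hAup : IsUpperSet A := fun f f' hle hf => h𝓔 (Set.union_subset_union_right _ (farAtoms_monoG hle)) hf
  have hBlow : IsLowerSet (flipAll ⁻¹' A) :=
    fun f f' hle hf => hAup (flipAll_antitone' hle) hf
  have hAB : flipAll ⁻¹' (flipAll ⁻¹' A) = A := by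
    ext f
    simp only [Set.mem_preimage, flipAll_involutive f]
  have cube := card_inter_le_of_cube (isLowerSet_DqG h𝒯 q) hAup hBlow hAB
  have e1 : ((QFG F 𝒯).filter fun x => x.2 = q ∧ EBTG F x ∈ 𝓔).card =
      (Finset.univ.filter (· ∈ DqG F 𝒯 q ∩ A)).card := by
    refine Finset.card_bij' (fun x _ => x.1) (fun f _ => (f, q)) ?_ ?_ ?_ ?_
    · intro x hx
      rw [Finset.mem_filter, mem_QFG] at hx
      obtain ⟨⟨-, ht⟩, hq, hE⟩ := hx
      rw [Finset.mem_filter]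
      refine ⟨Finset.mem_univ _, ?_, ?_⟩
      · show (x.1, typG F q) ∈ 𝒯
        rw [← hq]; exact ht
      · show Sum.inl '' EBG F q ∪ farAtoms x.1 ∈ 𝓔
        rw [← hq]; exact hE
    · intro f hf
      rw [Finset.mem_filter] at hf
      obtain ⟨-, hD, hE⟩ := hf
      rw [Finset.mem_filter, mem_QFG]
      exact ⟨⟨hl, hD⟩, rfl, hE⟩
    · intro x hx
      rw [Finset.mem_filter] at hx
      exact Prod.ext rfl hx.2.1.symm
    · intro f _
      rfl
  have e2 : ((QFG F 𝒯).filter fun x => x.2 = q ∧ EBFG F x ∈ 𝓔).card =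
      (Finset.univ.filter (· ∈ DqG F 𝒯 q ∩ flipAll ⁻¹' A)).card := by
    refine Finset.card_bij' (fun x _ => x.1) (fun f _ => (f, q)) ?_ ?_ ?_ ?_
    · intro x hx
      rw [Finset.mem_filter, mem_QFG] at hx
      obtain ⟨⟨-, ht⟩, hq, hE⟩ := hx
      rw [Finset.mem_filter]
      refine ⟨Finset.mem_univ _, ?_, ?_⟩
      · show (x.1, typG F q) ∈ 𝒯
        rw [← hq]; exact ht
      · show Sum.inl '' EBG F q ∪ farAtoms (flipAll x.1) ∈ 𝓔
        rw [← hq]; exact hE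
    · intro f hf
      rw [Finset.mem_filter] at hf
      obtain ⟨-, hD, hE⟩ := hf
      rw [Finset.mem_filter, mem_QFG]
      exact ⟨⟨hl, hD⟩, rfl, hE⟩
    · intro x hx
      rw [Finset.mem_filter] at hx
      exact Prod.ext rfl hx.2.1.symm
    · intro f _
      rfl
  rw [e1, e2]
  exact cube

/-- **THE ABSTRACT THEOREM OF BOUNDARY (iv), k = 2 PURE, WITH FAR ARMS**. -/
theorem card_le_crossGenFar (h𝒯 : IsUpFG F 𝒯) (h𝓔 : IsUpperSet 𝓔) :
    ((QFG F 𝒯).filter fun x => ERFG F x ∈ 𝓔).card ≤ ((QFG F 𝒯).filter fun x => EBFG F x ∈ 𝓔).card := by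
  -- sum over the far-arm bits, then over the points
  have h1 : ((QFG F 𝒯).filter fun x => ERFG F x ∈ 𝓔).card =
      ∑ f : Config κ, ((QFG F 𝒯).filter fun x => x.1 = f ∧ ERFG F x ∈ 𝓔).card := by
    rw [Finset.card_eq_sum_card_fiberwise (f := Prod.fst) (t := Finset.univ) (fun _ _ => Finset.mem_univ _)]
    refine Finset.sum_congr rfl fun f _ => ?_
    rw [Finset.filter_filter]
    congr 1
    apply Finset.filter_congr
    intro x _
    exact and_comm
  have h2 : ((QFG F 𝒯).filter fun x => EBTG F x ∈ 𝓔).card =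
      ∑ f : Config κ, ((QFG F 𝒯).filter fun x => x.1 = f ∧ EBTG F x ∈ 𝓔).card := by
    rw [Finset.card_eq_sum_card_fiberwise (f := Prod.fst) (t := Finset.univ) (fun _ _ => Finset.mem_univ _)]
    refine Finset.sum_congr rfl fun f _ => ?_
    rw [Finset.filter_filter]
    congr 1
    apply Finset.filter_congr
    intro x _
    exact and_comm
  have h3 : ((QFG F 𝒯).filter fun x => EBTG F x ∈ 𝓔).card =
      ∑ q : PtG W ι, ((QFG F 𝒯).filter fun x => x.2 = q ∧ EBTG F x ∈ 𝓔).card := by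
    rw [Finset.card_eq_sum_card_fiberwise (f := Prod.snd) (t := Finset.univ) (fun _ _ => Finset.mem_univ _)]
    refine Finset.sum_congr rfl fun q _ => ?_
    rw [Finset.filter_filter]
    congr 1
    apply Finset.filter_congr
    intro x _
    exact and_comm
  have h4 : ((QFG F 𝒯).filter fun x => EBFG F x ∈ 𝓔).card =
      ∑ q : PtG W ι, ((QFG F 𝒯).filter fun x => x.2 = q ∧ EBFG F x ∈ 𝓔).card := by
    rw [Finset.card_eq_sum_card_fiberwise (f := Prod.snd) (t := Finset.univ) (fun _ _ => Finset.mem_univ _)]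
    refine Finset.sum_congr rfl fun q _ => ?_
    rw [Finset.filter_filter]
    congr 1
    apply Finset.filter_congr
    intro x _
    exact and_comm
  calc ((QFG F 𝒯).filter fun x => ERFG F x ∈ 𝓔).card
      = ∑ f : Config κ, ((QFG F 𝒯).filter fun x => x.1 = f ∧ ERFG F x ∈ 𝓔).card := h1
    _ ≤ ∑ f : Config κ, ((QFG F 𝒯).filter fun x => x.1 = f ∧ EBTG F x ∈ 𝓔).card :=
        Finset.sum_le_sum fun f _ => card_frozen_leG h𝒯 h𝓔 f
    _ = ((QFG F 𝒯).filter fun x => EBTG F x ∈ 𝓔).card := h2.symm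
    _ = ∑ q : PtG W ι, ((QFG F 𝒯).filter fun x => x.2 = q ∧ EBTG F x ∈ 𝓔).card := h3
    _ ≤ ∑ q : PtG W ι, ((QFG F 𝒯).filter fun x => x.2 = q ∧ EBFG F x ∈ 𝓔).card :=
        Finset.sum_le_sum fun q _ => card_far_leG h𝒯 h𝓔 q
    _ = ((QFG F 𝒯).filter fun x => EBFG F x ∈ 𝓔).card := h4.symm

end Thm

end CrossArm

end Summit.Ventures.PercRepro2
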